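import Literature.AlgebraicGeometry.Resolution.ApproximationDegree
import HarnessLib

/-!
# The relative approximation degree: independence of the approximant and multiplicativity

Topic: `Literature/AlgebraicGeometry/Resolution` (valued function fields). Continuation of
`ApproximationDegree.lean` (F.-V. Kuhlmann, I. Vlahu, *The relative approximation degree in
valued function fields*, Math. Z. 276 (2014) = arXiv:1304.0200), for transcendental immediate
approximation types `appr(x, K)`:

> **Lemma 7.2.** Take another polynomial `g ∈ K[X]` … such that `appr(x,K)` fixes the value of
> `f − g`. If `appr(f(x),K) = appr(g(x),K)`, then `𝐡_K(x:f) = 𝐡_K(x:g)` and `β_K(x:f) = β_K(x:g)`.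
> **Lemma 10.6.** … `𝐡_K(x:z) = 𝐡_K(x:y) · 𝐡_K(y:z)` [proof: "`v(g(f(x)) − g(f(c))) = v g_{𝐡₁}(f(c))`
> `+ 𝐡₁ · (v f_{𝐡₂}(c) + 𝐡₂ · v(x − c))`"].

Both in the form needed for Cor. 10.8 ("`K(x)^h = K(y)^h ⟺ 𝐡_K(x:y) = 1`") and §12–14 (the
pull down of henselian rationality through tame extensions, the algebraic counterpart of the
descent step of Temkin 2013, Thm. 3.2.3): PROVED, no definitions, no named facts.

* `approximationDegree_congr` — **Lemma 7.2** [cite: KuhlmannVlahu2014, Lemma 7.2].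
* `approximationDegree_comp` — **Lemma 10.6, polynomial case** [cite: KuhlmannVlahu2014, Lemma 10.6].

## Sources

* F.-V. Kuhlmann, I. Vlahu, Math. Z. 276 (2014) = arXiv:1304.0200: Lemma 7.2 (p. 16), Lemmas
  8.1–8.2, Lemma 10.3, Lemma 10.6 and its proof (p. 21), Cor. 10.8. [KuhlmannVlahu2014]

## Rendering notes

As in `ApproximationDegree.lean`; "`v(f(x) − g(x)) ≥ dist(f(x), K)`" is rendered as
`|f(x) − g(x)| ≤ |f(x) − b|` for all `b ∈ K`.
-/

noncomputable section

open Polynomial Finset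

namespace Literature.AlgebraicGeometry.Resolution

universe u

variable {Ω : Type u} [Field Ω] (V : ValuationSubring Ω) (K : Subfield Ω)

/-! ### Lemma 7.2: polynomials with close values at `x` have the same `(β, 𝐡)` -/

/-- **Kuhlmann–Vlahu 2014, Lemma 7.2 (with Lemma 10.3): the relative approximation degree and
constant depend only on the approximation type of the value.** Let `x ∉ K` with `(K(x)|K, V)`
immediate of transcendental approximation type, and `f, g` polynomials over `K` such that
`g(x)` is at least as close to `f(x)` as every element of `K` (`|f(x) − g(x)| ≤ |f(x) − b|` for
all `b ∈ K`; "`v(f(x) − g(x)) ≥ dist(f(x), K)`"). If `|f(x) − f(c)| = β |x − c|^k` (`β ≠ 0`,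
`k ≥ 1`) for all `c ∈ K` close to `x`, then also `|g(x) − g(c)| = β |x − c|^k` for all `c ∈ K`
close to `x`. PROVED: `|f(c) − g(c)| = |f(x) − g(x)| =: w` eventually (Cor. 7.1), and
`w < β|x − c|^k` eventually since these values decrease strictly and bound `w` from above
(`f(c) ∈ K`). [cite: KuhlmannVlahu2014, Lemma 7.2] -/
theorem approximationDegree_congr {x : Ω} (hxK : x ∉ K)
    (hval : ∀ w ∈ Subfield.closure ((K : Set Ω) ∪ {x}), w ≠ 0 → ∃ b ∈ K,
      V.valuation w = V.valuation b)
    (hres : ∀ w ∈ Subfield.closure ((K : Set Ω) ∪ {x}), w ∈ V → ∃ c ∈ K,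
      V.valuation (w - c) < 1)
    (h3 : ∀ g : Polynomial Ω, (∀ k, g.coeff k ∈ K) → ∃ a₀ ∈ K, ∃ α : V.ValueGroup,
      ∀ a ∈ K, V.valuation (x - a) ≤ V.valuation (x - a₀) → V.valuation (g.eval a) = α)
    {f g : Polynomial Ω} (hf : ∀ k, f.coeff k ∈ K) (hg : ∀ k, g.coeff k ∈ K)
    (hclose : ∀ b ∈ K, V.valuation (f.eval x - g.eval x) ≤ V.valuation (f.eval x - b))
    {β : V.ValueGroup} (hβ : β ≠ 0) {k : ℕ} (hk : k ≠ 0) {a₀ : Ω} (ha₀K : a₀ ∈ K)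
    (hfk : ∀ c ∈ K, V.valuation (x - c) ≤ V.valuation (x - a₀) →
      V.valuation (f.eval x - f.eval c) = β * V.valuation (x - c) ^ k) :
    ∃ a₁ ∈ K, ∀ c ∈ K, V.valuation (x - c) ≤ V.valuation (x - a₁) →
      V.valuation (g.eval x - g.eval c) = β * V.valuation (x - c) ^ k := by
  classical
  have hxa : ∀ c ∈ K, V.valuation (x - c) ≠ 0 := fun c hc =>
    (_root_.map_ne_zero _).mpr fun h0 => hxK (by rw [sub_eq_zero.mp h0]; exact hc)
  -- `|f(c) - g(c)| = |f(x) - g(x)| =: w` near `x`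
  set d : Polynomial Ω := f - g with hd
  have hdK : ∀ k, d.coeff k ∈ K := fun k => by rw [hd, coeff_sub]; exact sub_mem (hf k) (hg k)
  obtain ⟨a₂, ha₂K, h₂⟩ := valuation_eval_eq_of_kaplansky V K hxK hval hres h3 hdK
  -- a common centre `a₃`, and one step closer `a₁`
  obtain ⟨a₃, ha₃K, ha₃⟩ : ∃ a₃ ∈ K, V.valuation (x - a₃) ≤ V.valuation (x - a₀) ∧
      V.valuation (x - a₃) ≤ V.valuation (x - a₂) := by
    rcases le_total (V.valuation (x - a₀)) (V.valuation (x - a₂)) with h | h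
    · exact ⟨a₀, ha₀K, le_rfl, h⟩
    · exact ⟨a₂, ha₂K, h, le_rfl⟩
  obtain ⟨a₁, ha₁K, h₁⟩ := exists_valuation_sub_lt V K hxK hval hres ha₃K
  refine ⟨a₁, ha₁K, fun c hc hle => ?_⟩
  have hc₃ : V.valuation (x - c) ≤ V.valuation (x - a₃) := hle.trans h₁.le
  have hfc := hfk c hc (hc₃.trans ha₃.1)
  -- `w < β t^k`: `w ≤ |f(x) - f(a₁')|` for the closer point and strict decrease
  have hw : V.valuation (f.eval x - g.eval x) < β * V.valuation (x - c) ^ k := by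
    -- one more step closer than `c`
    obtain ⟨c', hc'K, hc'⟩ := exists_valuation_sub_lt V K hxK hval hres hc
    have hfc'K : f.eval c' ∈ K := eval_mem_subfield_of_coeff_mem hf hc'K
    have h1 : V.valuation (f.eval x - g.eval x) ≤ V.valuation (f.eval x - f.eval c') :=
      hclose _ hfc'K
    have h2 : V.valuation (f.eval x - f.eval c') = β * V.valuation (x - c') ^ k :=
      hfk c' hc'K (hc'.le.trans (hc₃.trans ha₃.1))
    have h3' : β * V.valuation (x - c') ^ k < β * V.valuation (x - c) ^ k :=
      mul_lt_mul_of_pos_left (pow_lt_pow_left₀ hc' zero_le hk) (zero_lt_iff.mpr hβ)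
    exact lt_of_le_of_lt (h1.trans h2.le) h3'
  have hdc : V.valuation (d.eval x - d.eval c) < β * V.valuation (x - c) ^ k := by
    rcases (h₂ c hc (hc₃.trans ha₃.2)).2 with hlt | heq
    · refine lt_trans hlt ?_
      rw [hd, eval_sub]; exact hw
    · rw [heq, sub_self, map_zero]
      exact mul_pos (zero_lt_iff.mpr hβ) (pow_pos (zero_lt_iff.mpr (hxa c hc)) _)
  -- `g(x) - g(c) = (f(x) - f(c)) - (d(x) - d(c))`
  have hid : g.eval x - g.eval c = (f.eval x - f.eval c) - (d.eval x - d.eval c) := by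
    rw [hd, eval_sub, eval_sub]; ring
  rw [hid, Valuation.map_sub_eq_of_lt_left _ (by rw [hfc]; exact hdc), hfc]

/-! ### Lemma 10.6 (polynomial case): multiplicativity under composition -/

/-- **Kuhlmann–Vlahu 2014, Lemma 10.6 for polynomials: `𝐡_K(x : g∘f) = 𝐡_K(x : f) · 𝐡_K(f(x) : g)`.**
Let `x ∉ K` with `(K(x)|K, V)` immediate of transcendental approximation type, `f` a polynomial
over `K` with `|f(x) − f(c)| = β_f |x − c|^{k_f}` for `c ∈ K` close to `x` (`β_f ≠ 0`, `k_f ≥ 1`;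
`x` transcendental, so `y = f(x) ∉ K`), and `g` a polynomial over `K` with
`|g(y) − g(a)| = β_g |y − a|^{k_g}` for `a ∈ K` close to `y` (the approximation type of `y` over
`K`, along which `f(c) ↗ y`, Lemma 8.2). Then `|g(f(x)) − g(f(c))| = β_g β_f^{k_g} |x − c|^{k_f k_g}`
for `c ∈ K` close to `x` ("`v(g(f(x)) − g(f(c))) = v g_{𝐡₁}(f(c)) + 𝐡₁ · (v f_{𝐡₂}(c) + 𝐡₂ · v(x − c))`",
proof of Lemma 10.6). PROVED. [cite: KuhlmannVlahu2014, Lemma 10.6] -/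
theorem approximationDegree_comp {x : Ω}
    (htrans : ∀ P : Polynomial Ω, (∀ k, P.coeff k ∈ K) → P.eval x = 0 → P = 0)
    (hval : ∀ w ∈ Subfield.closure ((K : Set Ω) ∪ {x}), w ≠ 0 → ∃ b ∈ K,
      V.valuation w = V.valuation b)
    (hres : ∀ w ∈ Subfield.closure ((K : Set Ω) ∪ {x}), w ∈ V → ∃ c ∈ K,
      V.valuation (w - c) < 1)
    (h3 : ∀ g : Polynomial Ω, (∀ k, g.coeff k ∈ K) → ∃ a₀ ∈ K, ∃ α : V.ValueGroup,
      ∀ a ∈ K, V.valuation (x - a) ≤ V.valuation (x - a₀) → V.valuation (g.eval a) = α)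
    {f g : Polynomial Ω} (hf : ∀ k, f.coeff k ∈ K) (hdegf : 0 < f.natDegree)
    {βf : V.ValueGroup} {kf : ℕ} {a₀ : Ω} (ha₀K : a₀ ∈ K)
    (hfk : ∀ c ∈ K, V.valuation (x - c) ≤ V.valuation (x - a₀) →
      V.valuation (f.eval x - f.eval c) = βf * V.valuation (x - c) ^ kf)
    {βg : V.ValueGroup} {kg : ℕ} {b₀ : Ω} (hb₀K : b₀ ∈ K)
    (hgk : ∀ a ∈ K, V.valuation (f.eval x - a) ≤ V.valuation (f.eval x - b₀) →
      V.valuation (g.eval (f.eval x) - g.eval a) = βg * V.valuation (f.eval x - a) ^ kg) :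
    ∃ a₁ ∈ K, ∀ c ∈ K, V.valuation (x - c) ≤ V.valuation (x - a₁) →
      V.valuation ((g.comp f).eval x - (g.comp f).eval c) =
        βg * βf ^ kg * V.valuation (x - c) ^ (kf * kg) := by
  classical
  -- `f(c)` enters the ball of `b₀` around `y = f(x)` for `c` close to `x` (Lemma 8.2)
  obtain ⟨c₁, hc₁K, hc₁a₀, hc₁⟩ :=
    exists_valuation_eval_sub_eval_lt V K htrans hval hres h3 hf hdegf hb₀K ha₀K
  refine ⟨c₁, hc₁K, fun c hc hle => ?_⟩
  have hca₀ : V.valuation (x - c) ≤ V.valuation (x - a₀) := hle.trans hc₁a₀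
  have hfc : V.valuation (f.eval x - f.eval c) = βf * V.valuation (x - c) ^ kf := hfk c hc hca₀
  have hfc₁ : V.valuation (f.eval x - f.eval c₁) = βf * V.valuation (x - c₁) ^ kf :=
    hfk c₁ hc₁K hc₁a₀
  -- `|y - f(c)| ≤ |y - f(c₁)| < |y - b₀|`
  have hball : V.valuation (f.eval x - f.eval c) ≤ V.valuation (f.eval x - b₀) := by
    have h1 : V.valuation (f.eval x - f.eval c) ≤ V.valuation (f.eval x - f.eval c₁) := by
      rw [hfc, hfc₁]
      exact mul_le_mul' le_rfl (pow_le_pow_left₀ zero_le hle kf)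
    exact h1.trans hc₁.le
  have hfcK : f.eval c ∈ K := eval_mem_subfield_of_coeff_mem hf hc
  rw [eval_comp, eval_comp, hgk _ hfcK hball, hfc, mul_pow, ← pow_mul, mul_assoc]

end Literature.AlgebraicGeometry.Resolution
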